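import Mathlib
import Literature.MathematicalPhysics.QuantumFieldTheory.Balaban1983to89.B12Average012Prop2
import Literature.MathematicalPhysics.QuantumFieldTheory.Balaban1983to89.B7Prop2SpecialUnitary

/-!
# `Balaban1983to89.B12Average09SpecialUnitary` — [Balaban1987RG1] (0.9) «if 𝐔_j ∈ G, then M({𝐔_j}) ∈ G also» for
# `G = SU(N)` — the paper's standing case «G is semisimple … a Lie subgroup of a group of complex unitary matrices,
# for example G ⊂ U(N)» (pp. 251–252) — PROVED for the averaged contour variables (0.11) and the average (0.12) of the
# b12 lineage (`𝐔(q,x) ∈ SU(N)`, `Ū(c) ∈ SU(N)` on regular `SU(N)`-valued configurations, radius `∝ 1/N`), and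
# [B7] Proposition 2 (54) for the `k`-fold (0.12)/(0.11) average WITH ALL LEVELS IN `SU(N)`

HONEST FRAMING (cell `lit-balaban`, verbatim): statement-level skeleton of published theorems with citation tags;
proofs where landed; nothing here is a claim about the Yang–Mills mass gap.

CITATION HEADER.  T. Bałaban, *Renormalization group approach to lattice gauge field theories. I*, Commun. Math.
Phys. **109** (1987) 249–301, doi:10.1007/bf01215223 [Balaban1987RG1] (cell paper B12 = «[I]»).  PDF held:
`paper:balaban1987-cmp109-rg-i-small-field` (journal page = PDF page + 248); pp. 251–254 [PDF 3–6] re-read this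
generation from the held text.  [12] = [B7] = [Balaban1985Averaging], Commun. Math. Phys. **98** (1985) 17–51,
Proposition 2 (52)–(54) p. 26 — quoted only through the tree (`B7.Prop2Printed`; the tree's `SU(N)` closure of the
model average (42) is `B7Prop2SpecialUnitary.bavg_mem_specialUnitaryUnits`, whose radius `Nt < π` cannot be dropped:
`B7Prop2SpecialUnitary.not_avgClosedAt_specialUnitary`).  Unit `lit-balaban-r09` gen 9 (display owner of CMP 109;
TAKING line `HOME/STATUS.md` 2026-08-21T08:5xZ), HOME `run/shared/lean/pub/lit-balaban/`; SKELETON rows `B12.Eq0.9`,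
`B12.Eq0.12`, `B12.Eq2.1` / `B12.Eq1.2` (the «Prop 2 [12]» sentences), `B7.Prop2` (consumer instance only).

WHAT IS PRINTED (verbatim).  [I] pp. 251–252: *«Field configurations have values in a compact Lie group G. … We
assume that G is semisimple and that it is a Lie subgroup of a group of complex unitary matrices, for example
G ⊂ U(N).»*  p. 253: *«if 𝐔_j ∈ G, then M({𝐔_j}) ∈ G also. (0.9)»*; *«𝐔(y,x) = M({U(Γ)}_{Γ∈𝐆(y,x)}). (0.11)»*.
p. 254, (0.12) and *«all results of the paper [12] are valid for it.»*  [B7] Proposition 2 p. 26 (tree leaf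
`B7.Prop2Printed`): *«If U satisfies (52) with α₀ ≤ c₂ = min{1/(3C₀), ½c′₂}, then |Ū^k(∂p) − 1| < α₀ + 2C₀α₀² <
2α₀, p ⊂ Ω^{(k)} (54).»*

DICTIONARY print → Lean (all PRE-EXISTING).  `G = SU(N) ⊂ M_N(ℂ)` with the operator norm ↦
`B7Prop2SpecialUnitary.specialUnitaryUnits n` (units of `Matrix n n ℂ` in Mathlib's `Matrix.specialUnitaryGroup`,
scope `Matrix.Norms.L2Operator`), `N = Fintype.card n`; (0.11) `𝐔(q,x)` ↦ `B12ContourAverage253.Tavg`; (0.12) `Ū(c)` ↦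
`B12SmallFieldRegion255.avgBar`; [B7] (43) for it ↦ `B12Average012Prop2.avgIter012`; `sup_p ‖U(∂p) − 1‖` ↦
`B12Average012Prop2.pdevZ`; constants `C₀ = B12Average012Prop2.C0A d = 500·64(d+1)²(d+4)²`, `c₂′ = B7Prop2Explicit.c2' d L`.

THE ARGUMENT FORMALISED.  (i) (0.11) (§ 2, `Tavg_mem_specialUnitaryUnits`): the relative family
`{U(Γ^π_{q,x})U(Γ_{q,x})⁻¹}_π` is `SU(N)`-valued and `(dL)²ε₀`-small (`B12ContourAverage253.rel_permT_small`), so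
the tree's solution of (0.10) lies in `SU(N)` by `FederbushMean.fedSol_mem_specialUnitaryGroup` (unitary by the
uniqueness argument, determinant one by `Tr log = 0`; radius `N·(dL)²ε₀ ≤ 1/3`), hence `𝐔(q,x) = X(x)⁻¹U(Γ_{q,x}) ∈
SU(N)`.  (ii) (0.12) (§ 2, `avgBar_mem_specialUnitaryUnits`): `Ū(c)` is unitary by
`B12Average012Prop2.avgBar_mem_unitaryUnits`; every (0.12) loop lies in `SU(N)` within `ω_A = 10(dL)²ε₀` of `1`
(`B12ContourAverage253.norm_loopW_Tavg_sub_one_le_local`), so `Tr log W^avg_x = 0` (`ExpMeanLog.trace_mlog_eq_zero`,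
needs `N·ω_A < π`) and `det Ū(c) = det e^{A(c)}·det U(c) = e^{Tr A(c)} = 1`
(`Literature.Analysis.Matrix.det_exp_eq_exp_trace`).  (iii) § 3: by [B7] Prop. 2 for the (0.12)/(0.11) average
(`B12Average012Prop2.prop2_012_lt_two`, applied at every level `j ≤ k` since (52) at level `k` implies (52) at level
`j`) each `Ū^j` is `ε`-regular with `ε < 2α₀`, so `(dL)²ε ≤ 1/512` and `N·10(dL)²ε ≤ N·20(dL)²α₀ ≤ 1/3`, and (ii)
propagates `SU(N)`-valuedness up the levels (`avgIter012_mem_specialUnitary`); `prop2_012_specialUnitary` packages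
(54) with the `SU(N)`-membership of all levels.

WHAT IS PROVED (kernel-checked, no `sorry`, axioms `propext`, `Classical.choice`, `Quot.sound`; NO definition, NO
`Prop` placeholder, net new unproved facts 0): `permT_mem_specialUnitaryUnits`, `lineR_mem_specialUnitaryUnits`,
**`Tavg_mem_specialUnitaryUnits`**, `loopW_Tavg_mem_specialUnitaryUnits`, **`avgBar_mem_specialUnitaryUnits`**,
**`avgIter012_mem_specialUnitary`**, **`prop2_012_specialUnitary`**.

DIVERGENCES FROM PRINT / WHAT IS NOT PROVED (honest scope).  (a) Those of `B12Average012Prop1`/`Prop2` (a): `ℤᵈ`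
corner cubes, the lineage's (0.10)–(0.12), weak inequalities, regularity on all plaquettes.  (b) `G = SU(N)` ONLY (a
general semisimple closed `G ⊂ U(N)` would need its logarithmic chart, cf. `BlockAveragingFederbushGValued.LogChart`;
not done).  (c) The `G`-dependent radii `N·(dL)²ε₀ ≤ 1/3`, `N·10(dL)²ε₀ ≤ 1/3`, `N·20(dL)²α₀ ≤ 1/3` are this file's
sufficient ones; that SOME `1/N` shrinkage is necessary for (0.9) on `SU(N)` is the tree's
`BlockAveragingFederbushRadius` / `B7Prop2SpecialUnitary` § 5, not re-derived here.  (d) Print's `Gᶜ`-valued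
configurations and the analyticity of `M` are not touched.
-/

noncomputable section

open NormedSpace Finset
open scoped Matrix.Norms.L2Operator

namespace Literature.MathematicalPhysics.QuantumFieldTheory.Balaban1983to89.B12Average09SpecialUnitary

open Literature.MathematicalPhysics.QuantumLattice (ZdEdge blockMap blockSites mem_blockSites_iff plaquetteHolonomyZd)
open B7Eq61Linearization (lineR)
open B7Prop1Explicit (U1 mem_U1)
open B7Prop2Explicit (unitaryUnits mem_unitaryUnits hol_mem_of c2')
open B7Prop2SpecialUnitary (specialUnitaryUnits mem_specialUnitaryUnits specialUnitaryUnits_le_unitaryUnits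
  specialUnitaryUnits_le_U1)
open B12HOperator267 (gammaT)
open B12AverageCorridor267 (Ustr loopW loopW_def avgM expU val_expU)
open B12PlaquetteLoop267 (hol_seg_eq_lineR)
open B12ContourAverage253 (rel permT permT_one fedUnit val_fedUnit Tavg Tavg_eq rel_permT_small omegaA
  norm_loopW_Tavg_sub_one_le_local)
open B12SmallFieldRegion255 (avgBar)
open B12Average012Prop2 (pdevZ pdevZ_nonneg le_pdevZ C0A C0A_pos avgIter012 avgIter012_zero avgIter012_succ
  prop2_012 prop2_012_lt_two avgBar_mem_unitaryUnits)
open FederbushMean (fedSol fedSol_mem_specialUnitaryGroup)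
open MatrixLog (mlog)

variable {d : ℕ} {n : Type*} [Fintype n] [DecidableEq n] [Nonempty n] {L : ℕ}

/-! ## § 1  Transporters of an `SU(N)`-valued configuration -/

omit [Nonempty n] in
/-- [cite: Balaban1987RG1, p.252] every contour transporter `U(Γ^π_{q,x})` of an `SU(N)`-valued configuration lies in
`SU(N)`. -/
theorem permT_mem_specialUnitaryUnits (U : ZdEdge d → (Matrix n n ℂ)ˣ) (hU : ∀ b, U b ∈ specialUnitaryUnits n)
    (π : Equiv.Perm (Fin d)) (x : Fin d → ℤ) : permT L U π x ∈ specialUnitaryUnits n := by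
  unfold permT
  exact hol_mem_of (fun z κ => hU (z, κ)) _ _

omit [Nonempty n] in
/-- [cite: Balaban1987RG1, (0.12) p.254] straight transporters `U([x, x + m e_μ])` of an `SU(N)`-valued
configuration lie in `SU(N)`. -/
theorem lineR_mem_specialUnitaryUnits (U : ZdEdge d → (Matrix n n ℂ)ˣ) (hU : ∀ b, U b ∈ specialUnitaryUnits n)
    (x : Fin d → ℤ) (μ : Fin d) (m : ℕ) : lineR U x μ m ∈ specialUnitaryUnits n := by
  rw [← hol_seg_eq_lineR]
  exact hol_mem_of (fun z κ => hU (z, κ)) _ _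

/-! ## § 2  (0.9) for `G = SU(N)`: the averaged contour variable (0.11) and the average (0.12) are `SU(N)`-valued -/

/-- [cite: Balaban1987RG1, (0.9) p.253] **(0.9) FOR `G = SU(N)` AND THE AVERAGED CONTOUR VARIABLE (0.11)**: on an
`ε₀`-regular `SU(N)`-valued configuration with `(dL)²ε₀ ≤ 1/100` and `N·(dL)²ε₀ ≤ 1/3`, `𝐔(q,x) ∈ SU(N)`
(Federbush's solution of (0.10) for an `SU(N)`-family of radius `δ ≤ 1/100`, `Nδ ≤ 1/3`, lies in `SU(N)`:
`FederbushMean.fedSol_mem_specialUnitaryGroup`; the `1/N` radius is necessary, `BlockAveragingFederbushRadius`). -/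
theorem Tavg_mem_specialUnitaryUnits (hL : 0 < L) (U : ZdEdge d → (Matrix n n ℂ)ˣ)
    (hU : ∀ b, U b ∈ specialUnitaryUnits n) {ε₀ : ℝ} (hε₀ : 0 ≤ ε₀) (hsm : ((d : ℝ) * L) ^ 2 * ε₀ ≤ 1 / 100)
    (hN : (Fintype.card n : ℝ) * (((d : ℝ) * L) ^ 2 * ε₀) ≤ 1 / 3)
    (h44 : ∀ (p : Fin d → ℤ) (i j : Fin d), i ≠ j →
      ‖((plaquetteHolonomyZd U p i j : (Matrix n n ℂ)ˣ) : Matrix n n ℂ) - 1‖ ≤ ε₀)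
    (x : Fin d → ℤ) : Tavg L U x ∈ specialUnitaryUnits n := by
  haveI : NeZero L := ⟨hL.ne'⟩
  have hU1 : ∀ b, U b ∈ U1 (Matrix n n ℂ) := fun b => specialUnitaryUnits_le_U1 (hU b)
  have hx : x ∈ blockSites L (blockMap L x) := (mem_blockSites_iff L _ x).2 rfl
  have hF : ∀ π, permT L U π x ∈ specialUnitaryUnits n := fun π => permT_mem_specialUnitaryUnits U hU π x
  have hrelS : ∀ π, rel (fun π : Equiv.Perm (Fin d) => permT L U π x) 1 π ∈ Matrix.specialUnitaryGroup n ℂ :=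
    fun π => by
      have h := (specialUnitaryUnits n).mul_mem (hF π) ((specialUnitaryUnits n).inv_mem (hF 1))
      rw [mem_specialUnitaryUnits, Units.val_mul] at h
      exact h
  have hrel : ∀ π, ‖rel (fun π : Equiv.Perm (Fin d) => permT L U π x) 1 π - 1‖ ≤ ((d : ℝ) * L) ^ 2 * ε₀ :=
    fun π => rel_permT_small hL U (fun b => (mem_U1.mp (hU1 b)).1) (fun b => (mem_U1.mp (hU1 b)).2) hε₀ hx
      (fun p i j hij _ _ => h44 p i j hij) π
  have hsol : fedSol (rel (fun π : Equiv.Perm (Fin d) => permT L U π x) 1) ∈ Matrix.specialUnitaryGroup n ℂ :=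
    fedSol_mem_specialUnitaryGroup hsm hN hrelS hrel
  have hunit : fedUnit (rel (fun π : Equiv.Perm (Fin d) => permT L U π x) 1) ∈ specialUnitaryUnits n := by
    rw [mem_specialUnitaryUnits, val_fedUnit]
    exact hsol
  rw [Tavg_eq hL, ← permT_one hL]
  exact (specialUnitaryUnits n).mul_mem ((specialUnitaryUnits n).inv_mem hunit) (hF 1)

/-- [cite: Balaban1987RG1, (0.12) p.254] the (0.12) loops `W^avg_x` of an `SU(N)`-valued regular configuration lie in
`SU(N)`. -/
theorem loopW_Tavg_mem_specialUnitaryUnits (hL : 0 < L) (U : ZdEdge d → (Matrix n n ℂ)ˣ)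
    (hU : ∀ b, U b ∈ specialUnitaryUnits n) {ε₀ : ℝ} (hε₀ : 0 ≤ ε₀) (hsm : ((d : ℝ) * L) ^ 2 * ε₀ ≤ 1 / 100)
    (hN : (Fintype.card n : ℝ) * (((d : ℝ) * L) ^ 2 * ε₀) ≤ 1 / 3)
    (h44 : ∀ (p : Fin d → ℤ) (i j : Fin d), i ≠ j →
      ‖((plaquetteHolonomyZd U p i j : (Matrix n n ℂ)ˣ) : Matrix n n ℂ) - 1‖ ≤ ε₀)
    (c : ZdEdge d) (x : Fin d → ℤ) :
    loopW L (fun U : ZdEdge d → (Matrix n n ℂ)ˣ => Tavg L U) U c x ∈ specialUnitaryUnits n := by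
  rw [loopW_def]
  have hT := fun z => Tavg_mem_specialUnitaryUnits hL U hU hε₀ hsm hN h44 z
  refine (specialUnitaryUnits n).mul_mem ((specialUnitaryUnits n).mul_mem ((specialUnitaryUnits n).mul_mem (hT x)
    (lineR_mem_specialUnitaryUnits U hU x c.2 L)) ((specialUnitaryUnits n).inv_mem (hT _)))
    ((specialUnitaryUnits n).inv_mem ?_)
  exact lineR_mem_specialUnitaryUnits U hU _ c.2 L

/-- [cite: Balaban1987RG1, (0.12) p.254] **THE AVERAGE (0.12) OVER THE AVERAGED CONTOUR VARIABLES (0.11) OF AN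
`SU(N)`-VALUED CONFIGURATION IS `SU(N)`-VALUED** — the paper's standing assumption «G is semisimple … for example
G ⊂ U(N)» (p. 251) in the case `G = SU(N)`: on an `ε₀`-regular configuration with `(dL)²ε₀ ≤ 1/100` and
`N·10(dL)²ε₀ ≤ 1/3`, `Ū(c)` is unitary (`B12Average012Prop2.avgBar_mem_unitaryUnits`) and `det Ū(c) =
det e^{A(c)} · det U(c) = e^{Tr A(c)} = exp[Σ_x L⁻ᵈ Tr log W^avg_x] = e⁰ = 1`, because every loop lies in `SU(N)`
within `ω_A = 10(dL)²ε₀` of `1` and `Tr log W = 0` there (`ExpMeanLog.trace_mlog_eq_zero`, `N·ω_A < π`). -/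
theorem avgBar_mem_specialUnitaryUnits (hL : 0 < L) (hd : 1 ≤ d) (U : ZdEdge d → (Matrix n n ℂ)ˣ)
    (hU : ∀ b, U b ∈ specialUnitaryUnits n) {ε₀ : ℝ} (hε₀ : 0 ≤ ε₀) (hsm : ((d : ℝ) * L) ^ 2 * ε₀ ≤ 1 / 100)
    (hN : (Fintype.card n : ℝ) * (10 * (((d : ℝ) * L) ^ 2 * ε₀)) ≤ 1 / 3)
    (h44 : ∀ (p : Fin d → ℤ) (i j : Fin d), i ≠ j →
      ‖((plaquetteHolonomyZd U p i j : (Matrix n n ℂ)ˣ) : Matrix n n ℂ) - 1‖ ≤ ε₀)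
    (c : ZdEdge d) : avgBar L U c ∈ specialUnitaryUnits n := by
  letI : CStarAlgebra (Matrix n n ℂ) := {}
  set δ : ℝ := ((d : ℝ) * L) ^ 2 * ε₀ with hδ
  have hδ0 : 0 ≤ δ := by positivity
  have hcard : (0 : ℝ) ≤ Fintype.card n := Nat.cast_nonneg _
  have hN' : (Fintype.card n : ℝ) * δ ≤ 1 / 3 := by nlinarith
  have hU1 : ∀ b, U b ∈ U1 (Matrix n n ℂ) := fun b => specialUnitaryUnits_le_U1 (hU b)
  have hUu : ∀ b, U b ∈ unitaryUnits (Matrix n n ℂ) := fun b => specialUnitaryUnits_le_unitaryUnits (hU b)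
  have hunit : avgBar L U c ∈ unitaryUnits (Matrix n n ℂ) := avgBar_mem_unitaryUnits hL hd U hUu hε₀ hsm h44 c
  have hloopS := fun x => loopW_Tavg_mem_specialUnitaryUnits hL U hU hε₀ hsm hN' h44 c x
  have htr : ∀ x ∈ blockSites L c.1,
      (mlog ((loopW L (fun U : ZdEdge d → (Matrix n n ℂ)ˣ => Tavg L U) U c x : (Matrix n n ℂ)ˣ) :
        Matrix n n ℂ)).trace = 0 := by
    intro x hx
    have hsmall := norm_loopW_Tavg_sub_one_le_local hL hd U (fun b => (mem_U1.mp (hU1 b)).1)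
      (fun b => (mem_U1.mp (hU1 b)).2) hε₀ hsm c (fun p i j hij _ _ => h44 p i j hij) hx
    have hω : omegaA d L ε₀ = 10 * δ := by rw [omegaA, hδ]; ring
    rw [hω] at hsmall
    refine ExpMeanLog.trace_mlog_eq_zero (hloopS x) (hsmall.trans (by nlinarith)) ?_
    calc (Fintype.card n : ℝ) * ‖((loopW L (fun U : ZdEdge d → (Matrix n n ℂ)ˣ => Tavg L U) U c x :
            (Matrix n n ℂ)ˣ) : Matrix n n ℂ) - 1‖
        ≤ (Fintype.card n : ℝ) * (10 * δ) := mul_le_mul_of_nonneg_left hsmall hcard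
      _ ≤ 1 / 3 := hN
      _ < Real.pi := by have := Real.pi_gt_three; linarith
  have hA : (∑ x ∈ blockSites L c.1, ((L : ℂ) ^ d)⁻¹ •
      mlog ((loopW L (fun U : ZdEdge d → (Matrix n n ℂ)ˣ => Tavg L U) U c x : (Matrix n n ℂ)ˣ) :
        Matrix n n ℂ)).trace = 0 := by
    rw [Matrix.trace_sum]
    exact sum_eq_zero fun x hx => by rw [Matrix.trace_smul, htr x hx, smul_zero]
  have hdetS : ((Ustr L U c : (Matrix n n ℂ)ˣ) : Matrix n n ℂ).det = 1 :=
    (Matrix.mem_specialUnitaryGroup_iff.1 (lineR_mem_specialUnitaryUnits U hU _ c.2 L)).2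
  rw [mem_specialUnitaryUnits, Matrix.mem_specialUnitaryGroup_iff]
  refine ⟨hunit, ?_⟩
  show ((expU (∑ x ∈ blockSites L c.1, ((L : ℂ) ^ d)⁻¹ •
      mlog ((loopW L (fun U : ZdEdge d → (Matrix n n ℂ)ˣ => Tavg L U) U c x : (Matrix n n ℂ)ˣ) :
        Matrix n n ℂ)) * Ustr L U c : (Matrix n n ℂ)ˣ) : Matrix n n ℂ).det = 1
  rw [Units.val_mul, Matrix.det_mul, hdetS, mul_one, val_expU, Literature.Analysis.Matrix.det_exp_eq_exp_trace,
    hA, exp_zero]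

/-! ## § 3  [B7] Proposition 2 for `SU(N)`: every iterated (0.12)/(0.11) average stays in `SU(N)` -/

/-- [cite: Balaban1985Averaging, (52)–(53) p.26] **ALL LEVELS `Ū^j`, `j ≤ k`, STAY IN `SU(N)`**: under (52)
`sup_p ‖U(∂p) − 1‖ < α₀η²`, `η = L^{−k}`, `C₀α₀ ≤ 1/3`, `2α₀ ≤ c₂′` (the hypotheses of
`B12Average012Prop2.prop2_012`) and ONE `G`-dependent smallness `N·20(dL)²α₀ ≤ 1/3`: by (54) at every level
`j ≤ k` the configuration `Ū^j` is `ε`-regular with `ε < 2α₀` (`prop2_012_lt_two` at `k := j`), hence § 2 applies. -/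
theorem avgIter012_mem_specialUnitary (hL : 2 ≤ L) (hd : 1 ≤ d) (k : ℕ) (U : ZdEdge d → (Matrix n n ℂ)ˣ)
    (hU : ∀ b, U b ∈ specialUnitaryUnits n) {α₀ : ℝ} (hα : 0 < α₀) (hα3 : C0A d * α₀ ≤ 1 / 3)
    (hα2 : 2 * α₀ ≤ c2' d L) (hN : (Fintype.card n : ℝ) * (20 * (((d : ℝ) * L) ^ 2 * α₀)) ≤ 1 / 3)
    (h52 : pdevZ U < α₀ * (((L : ℝ) ^ k)⁻¹) ^ 2) :
    ∀ j ≤ k, ∀ b, avgIter012 L U j b ∈ specialUnitaryUnits n := by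
  letI : CStarAlgebra (Matrix n n ℂ) := {}
  have hL1 : 1 ≤ L := le_trans (by norm_num) hL
  have hL0 : 0 < L := hL1
  have hL1r : (1 : ℝ) ≤ L := by exact_mod_cast hL1
  have hdr : (1 : ℝ) ≤ d := by exact_mod_cast hd
  have hcard : (0 : ℝ) ≤ Fintype.card n := Nat.cast_nonneg _
  have hUu : ∀ b, U b ∈ unitaryUnits (Matrix n n ℂ) := fun b => specialUnitaryUnits_le_unitaryUnits (hU b)
  -- `2α₀ ≤ c₂′` forces `(dL)²·2α₀ ≤ 1/512`
  have hsm2 : ((d : ℝ) * L) ^ 2 * (2 * α₀) ≤ 1 / 512 := by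
    have hpos : (0 : ℝ) < 512 * ((d : ℝ) + 1) * (d + 4) * (L : ℝ) ^ 2 := by positivity
    have h1 : 2 * α₀ ≤ 1 / (512 * ((d : ℝ) + 1) * (d + 4) * (L : ℝ) ^ 2) := hα2
    rw [le_div_iff₀ hpos] at h1
    have h2 : ((d : ℝ) * L) ^ 2 ≤ (d + 1) * (d + 4) * (L : ℝ) ^ 2 := by
      have : (d : ℝ) ^ 2 ≤ (d + 1) * (d + 4) := by nlinarith
      have hL2 : (0 : ℝ) ≤ (L : ℝ) ^ 2 := by positivity
      nlinarith
    have h3 : 0 ≤ 2 * α₀ := by linarith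
    nlinarith [mul_le_mul_of_nonneg_right h2 h3]
  -- (52) at level `k` implies (52) at every level `j ≤ k`
  have h52j : ∀ j ≤ k, pdevZ U < α₀ * (((L : ℝ) ^ j)⁻¹) ^ 2 := by
    intro j hj
    refine h52.trans_le (mul_le_mul_of_nonneg_left ?_ hα.le)
    have hjk : (L : ℝ) ^ j ≤ (L : ℝ) ^ k := pow_le_pow_right₀ hL1r hj
    have hj0 : (0 : ℝ) < (L : ℝ) ^ j := by positivity
    gcongr
  intro j
  induction j with
  | zero => intro _ b; simpa using hU b
  | succ j ih =>
      intro hjk b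
      have hjk' : j ≤ k := Nat.le_of_succ_le hjk
      have hUj : ∀ b, avgIter012 L U j b ∈ specialUnitaryUnits n := ih hjk'
      have hU1j : ∀ b, avgIter012 L U j b ∈ U1 (Matrix n n ℂ) := fun b => specialUnitaryUnits_le_U1 (hUj b)
      have hlt : pdevZ (avgIter012 L U j) < 2 * α₀ := prop2_012_lt_two hL hd j U hUu hα hα3 hα2 (h52j j hjk')
      set ε : ℝ := pdevZ (avgIter012 L U j) with hε
      have hε0 : 0 ≤ ε := pdevZ_nonneg _
      have hdl : 0 ≤ ((d : ℝ) * L) ^ 2 := by positivity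
      have hsm : ((d : ℝ) * L) ^ 2 * ε ≤ 1 / 100 := by
        have := mul_le_mul_of_nonneg_left hlt.le hdl
        linarith
      have hNε : (Fintype.card n : ℝ) * (10 * (((d : ℝ) * L) ^ 2 * ε)) ≤ 1 / 3 := by
        have h1 : 10 * (((d : ℝ) * L) ^ 2 * ε) ≤ 20 * (((d : ℝ) * L) ^ 2 * α₀) := by
          have := mul_le_mul_of_nonneg_left hlt.le hdl
          linarith
        exact (mul_le_mul_of_nonneg_left h1 hcard).trans hN
      have h44 : ∀ (x : Fin d → ℤ) (i i' : Fin d), i ≠ i' →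
          ‖((plaquetteHolonomyZd (avgIter012 L U j) x i i' : (Matrix n n ℂ)ˣ) : Matrix n n ℂ) - 1‖ ≤ ε :=
        fun x i i' _ => le_pdevZ hU1j x i i'
      rw [avgIter012_succ]
      exact avgBar_mem_specialUnitaryUnits hL0 hd _ hUj hε0 hsm hNε h44 b

/-- [cite: Balaban1987RG1, p.254] **[B7] PROPOSITION 2 (54) FOR THE `k`-FOLD (0.12)/(0.11) AVERAGE, `G = SU(N)`**
(the paper's semisimple `G ⊂ U(N)`): for an `SU(N)`-valued configuration `U` on `ℤᵈ` (`d ≥ 1`, `L ≥ 2`, operator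
norm) with `sup_p ‖U(∂p) − 1‖ < α₀η²`, `η = L^{−k}`, `C₀α₀ ≤ 1/3`, `2α₀ ≤ c₂′` and `N·20(dL)²α₀ ≤ 1/3`:
`sup_p ‖Ū^k(∂p) − 1‖ < α₀ + 2C₀α₀² < 2α₀` AND every `Ū^j`, `j ≤ k`, is `SU(N)`-valued (`C₀ = 500·64(d+1)²(d+4)²`,
`c₂′ = 1/(512(d+1)(d+4)L²)`). -/
theorem prop2_012_specialUnitary (hL : 2 ≤ L) (hd : 1 ≤ d) (k : ℕ) (U : ZdEdge d → (Matrix n n ℂ)ˣ)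
    (hU : ∀ b, U b ∈ specialUnitaryUnits n) {α₀ : ℝ} (hα : 0 < α₀) (hα3 : C0A d * α₀ ≤ 1 / 3)
    (hα2 : 2 * α₀ ≤ c2' d L) (hN : (Fintype.card n : ℝ) * (20 * (((d : ℝ) * L) ^ 2 * α₀)) ≤ 1 / 3)
    (h52 : pdevZ U < α₀ * (((L : ℝ) ^ k)⁻¹) ^ 2) :
    pdevZ (avgIter012 L U k) < α₀ + 2 * C0A d * α₀ ^ 2 ∧ pdevZ (avgIter012 L U k) < 2 * α₀ ∧
      ∀ j ≤ k, ∀ b, avgIter012 L U j b ∈ specialUnitaryUnits n := by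
  letI : CStarAlgebra (Matrix n n ℂ) := {}
  have hUu : ∀ b, U b ∈ unitaryUnits (Matrix n n ℂ) := fun b => specialUnitaryUnits_le_unitaryUnits (hU b)
  exact ⟨(prop2_012 hL hd k U hUu hα hα3 hα2 h52).1, prop2_012_lt_two hL hd k U hUu hα hα3 hα2 h52,
    avgIter012_mem_specialUnitary hL hd k U hU hα hα3 hα2 hN h52⟩

end Literature.MathematicalPhysics.QuantumFieldTheory.Balaban1983to89.B12Average09SpecialUnitary

end
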